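import Summits.CriticalPhenomena.CardyFormulaZ2.Theorems.CardySusyWardWeakHolomorphyCoreEstimate

/-!
# The bypass: `stub_composition` of line `Sketch` (crux `CardySusyWard.WeakHolomorphy`, stmt-CriticalPhenomena-11292)

Lead prover `prover-line-stmt-CriticalPhenomena-11292-0`.  The registered composition stub, PROVED:
from the four bookkeeping stubs (`stub_regroup`, `stub_calculus`, `stub_taylorComb`, `stub_count`,
all landed; here they enter as the hypotheses of the registered signature) and the two transfer
statements (the `L¹` vertex-relation defect bound and the `L¹` bounded anti-Kirchhoff splitting `C⁺`),
the crux quantity `δ^{5/3} Σ_z F_δ(z) ∂̄φ(z_δ)` tends to `0` along every admissible family for every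
test function.  Steps: (1) `finsum_eq_kappa_sum` — the `finsum` over `Sym2 (Site 2)` is the
vertex-indexed sum `κ Σ_p ∂̄φ(z_p) Σ_k Fd(c_{p,k})` (`Fd = bondDartObservable (Λ δ) δ (1/3)`), by the
sibling crux's exact vertex identity `dictionary_eventually` (`2cos(π/12)·F = Σ_{4 corners}`, off the
two `A`–`B` edges, which leave every compact eventually) and the support lemmas of the Negative file;
(2) `stub_coreEstimate` at one mesh; (3) an `ε/2`-argument along `𝓝[>] 0` (`δ^{2/3} → 0`).
References: Duminil-Copin–Smirnov 2012 (arXiv:1109.1549) §8.3, Conj. 8.7; crux workfiles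
`Cruxes/WeakHolomorphy/Lines/Sketch.lean`, `Disproof.lean §D`.
-/

noncomputable section

namespace Summit.CriticalPhenomena.CardyFormulaZ2.Theorems.WeakHolomorphy.SplitBypass

open scoped BigOperators Topology
open Filter Set MeasureTheory Complex
open _root_.Literature.Probability.LatticeModels
open _root_.Literature.Probability.RandomPlanarGeometry (DobrushinDomain)
open _root_.Literature.Probability.Percolation (BondConfig bondPercolation half)
open _root_.Literature.Barriers.CriticalPhenomena (medialCornersAt medialVertexOf halfCRForm HalfCRRelationAt)
open _root_.Literature.Barriers.CriticalPhenomena.HalfCRGreen (coeff twin)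
open Summit.CriticalPhenomena.CardyFormulaZ2.Theorems.ParafermionPrecompact.Negative (F IsFamily)
open Summit.CriticalPhenomena.CardyFormulaZ2.Cruxes.ParafermionPrecompact.KenyonStreamSecondRelation
  (mv ex pivotOf classOffset classComp dartField kappa)

/-! ## From the `finsum` over `Sym2` to the vertex-indexed corner sums -/

/-- **The dictionary step.** Eventually in `δ`, for every finite `S` containing all medial
vertices whose point lies in the `1`-thickening of `K = tsupport φ`, the crux's `finsum` equals
`κ · Σ_{p∈S} ∂̄φ(z_p) · Σ_k Fd(c_{p,k})` with `Fd = bondDartObservable (Λ δ) δ (1/3)`. [folklore] -/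
theorem finsum_eq_kappa_sum (D : DobrushinDomain) (Λ : ℝ → DiscreteDobrushin) (hΛ : IsFamily D Λ)
    (φ : ℂ → ℂ) (hc : HasCompactSupport φ) (hs : tsupport φ ⊆ D.carrier) :
    ∀ᶠ δ in 𝓝[>] (0:ℝ), ∀ S : Finset (Site 2 × Fin 2),
      (∀ p : Site 2 × Fin 2, medialPoint δ (medialVertexOf p) ∈ Metric.cthickening 1 (tsupport φ) → p ∈ S) →
      ∑ᶠ z : MedialVertex, F Λ δ z *
          ((fderiv ℝ φ (medialPoint δ z) 1 + Complex.I * fderiv ℝ φ (medialPoint δ z) Complex.I) / 2) =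
        (kappa : ℂ) * ∑ p ∈ S, (fderiv ℝ φ (medialPoint δ (medialVertexOf p)) 1 +
          Complex.I * fderiv ℝ φ (medialPoint δ (medialVertexOf p)) Complex.I) / 2 *
          ∑ k : Fin 4, bondDartObservable (Λ δ) δ (1 / 3) (medialCornersAt p.1 p.2 k) := by
  have hδΛ := hΛ.2.1
  filter_upwards [Summit.CriticalPhenomena.CardyFormulaZ2.Cruxes.ParafermionPrecompact.KenyonStreamSecondRelation.dictionary_eventually
    D Λ hΛ (tsupport φ) hc.isCompact hs, self_mem_nhdsWithin] with δ hdict hδpos S hS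
  -- support of the summand
  set g : MedialVertex → ℂ := fun z => F Λ δ z *
    ((fderiv ℝ φ (medialPoint δ z) 1 + Complex.I * fderiv ℝ φ (medialPoint δ z) Complex.I) / 2) with hg
  have hsupp : Function.support g ⊆ ↑(S.image medialVertexOf) := by
    intro z hz
    rw [Function.mem_support] at hz
    obtain ⟨hF, hψz⟩ := mul_ne_zero_iff.1 hz
    obtain ⟨p, rfl⟩ := exists_eq_medialVertexOf_of_F_ne_zero hF
    have hK : medialPoint δ (medialVertexOf p) ∈ tsupport φ := by
      by_contra h
      exact hψz (by simp [fderiv_of_notMem_tsupport ℝ h])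
    simp only [Finset.coe_image, Set.mem_image, Finset.mem_coe]
    exact ⟨p, hS p (Metric.self_subset_cthickening _ hK), rfl⟩
  rw [finsum_eq_sum_of_support_subset g hsupp,
    Finset.sum_image fun p _ q _ h => medialVertexOf_injective h, Finset.mul_sum]
  refine Finset.sum_congr rfl fun p _ => ?_
  simp only [hg]
  by_cases hK : medialPoint δ (medialVertexOf p) ∈ tsupport φ
  · obtain ⟨x, i⟩ := p
    have h := hdict x i (by rw [mv_eq_medialVertexOf]; exact hK)
    rw [mv_eq_medialVertexOf] at h
    rw [h, sum_classComp_pivotOf]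
    simp only [Summit.CriticalPhenomena.CardyFormulaZ2.Cruxes.ParafermionPrecompact.KenyonStreamSecondRelation.dartField,
      hδΛ δ]
    ring
  · simp [fderiv_of_notMem_tsupport ℝ hK]

/-! ## The composition (the bypass) -/

/-- **`stub_composition`, proved: the bypass.** From the four bookkeeping stubs and the two
transfer statements, `δ^{5/3} Σ_z F_δ(z) ∂̄φ(z_δ) → 0` along every admissible family for every
test function. [folklore] -/
theorem composition_holds (hR : (∀ (S : Finset (Site 2 × Fin 2)) (w : Site 2 × Fin 2 → Fin 4 → ℂ) (Φ : Site 2 × Site 2 → ℂ),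
      (∀ (p : Site 2 × Fin 2) (k : Fin 4), w p k ≠ 0 → p ∈ S ∧ twin p.1 p.2 k ∈ S) →
      ∑ p ∈ S, ∑ k : Fin 4, w p k * Φ (medialCornersAt p.1 p.2 k) =
        (1 / 2 : ℂ) * ∑ p ∈ S, ∑ k : Fin 4,
          (w p k + w (twin p.1 p.2 k) (k + 2)) * Φ (medialCornersAt p.1 p.2 k)))
    (hC : ∀ (φ : ℂ → ℂ), ContDiff ℝ (⊤ : ℕ∞) φ → HasCompactSupport φ →
      ∃ C : ℝ, ∀ (m v : ℂ), ‖v‖ ≤ 1 →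
        ‖φ (m + v) - φ (m - v) - 2 * fderiv ℝ φ m v‖ ≤ C * ‖v‖ ^ 3 ∧
        ‖fderiv ℝ φ (m + v) 1 + fderiv ℝ φ (m - v) 1 - 2 * fderiv ℝ φ m 1‖ ≤ C * ‖v‖ ^ 2 ∧
        ‖fderiv ℝ φ (m + v) Complex.I + fderiv ℝ φ (m - v) Complex.I - 2 * fderiv ℝ φ m Complex.I‖
          ≤ C * ‖v‖ ^ 2)
    (hT : ∃ C' : ℝ, ∀ (φ : ℂ → ℂ) (C : ℝ),
      (∀ (m v : ℂ), ‖v‖ ≤ 1 →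
        ‖φ (m + v) - φ (m - v) - 2 * fderiv ℝ φ m v‖ ≤ C * ‖v‖ ^ 3 ∧
        ‖fderiv ℝ φ (m + v) 1 + fderiv ℝ φ (m - v) 1 - 2 * fderiv ℝ φ m 1‖ ≤ C * ‖v‖ ^ 2 ∧
        ‖fderiv ℝ φ (m + v) Complex.I + fderiv ℝ φ (m - v) Complex.I - 2 * fderiv ℝ φ m Complex.I‖
          ≤ C * ‖v‖ ^ 2) →
      ∀ (δ : ℝ), 0 < δ → δ ≤ 1 → ∀ (p : Site 2 × Fin 2) (k : Fin 4),
        dist (medialPoint δ (medialVertexOf p)) (medialPoint δ (medialVertexOf (twin p.1 p.2 k))) ≤ δ ∧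
        ‖((fderiv ℝ φ (medialPoint δ (medialVertexOf p)) 1 +
              Complex.I * fderiv ℝ φ (medialPoint δ (medialVertexOf p)) Complex.I) / 2 +
            Complex.I * (-1) ^ (k.val + 1) *
              ((fderiv ℝ φ (medialPoint δ (medialVertexOf p)) 1 -
                Complex.I * fderiv ℝ φ (medialPoint δ (medialVertexOf p)) Complex.I) / 2) -
            2 * (1 - Complex.I) / δ * coeff Complex.I k * φ (medialPoint δ (medialVertexOf p))) +
          ((fderiv ℝ φ (medialPoint δ (medialVertexOf (twin p.1 p.2 k))) 1 +
              Complex.I * fderiv ℝ φ (medialPoint δ (medialVertexOf (twin p.1 p.2 k))) Complex.I) / 2 +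
            Complex.I * (-1) ^ ((k + 2 : Fin 4).val + 1) *
              ((fderiv ℝ φ (medialPoint δ (medialVertexOf (twin p.1 p.2 k))) 1 -
                Complex.I * fderiv ℝ φ (medialPoint δ (medialVertexOf (twin p.1 p.2 k))) Complex.I) / 2) -
            2 * (1 - Complex.I) / δ * coeff Complex.I (k + 2) *
              φ (medialPoint δ (medialVertexOf (twin p.1 p.2 k))))‖ ≤ C' * C * δ ^ 2)
    (hN : ∀ (K : Set ℂ), IsCompact K → ∃ C : ℝ, ∀ (δ : ℝ), 0 < δ → δ ≤ 1 →
      ∃ S : Finset (Site 2 × Fin 2),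
        (∀ p : Site 2 × Fin 2, medialPoint δ (medialVertexOf p) ∈ Metric.cthickening 1 K → p ∈ S) ∧
        δ ^ 2 * (S.card : ℝ) ≤ C)
    (hV : ∀ (D : DobrushinDomain) (Λ : ℝ → DiscreteDobrushin), IsFamily D Λ →
      ∀ (K : Set ℂ), IsCompact K → K ⊆ D.carrier → ∀ ε > (0:ℝ), ∀ᶠ δ in 𝓝[>] (0:ℝ),
        ∀ S : Finset (Site 2 × Fin 2), (∀ p ∈ S, medialPoint δ (medialVertexOf p) ∈ K) →
          ∑ p ∈ S, ‖halfCRForm Complex.I p (fun c => bondDartObservable (Λ δ) δ (1 / 3) c)‖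
            ≤ ε * δ ^ (-(2:ℝ) / 3))
    (hSpl : ∀ (D : DobrushinDomain) (Λ : ℝ → DiscreteDobrushin), IsFamily D Λ →
      ∀ (K : Set ℂ), IsCompact K → K ⊆ D.carrier → ∀ ε > (0:ℝ), ∀ᶠ δ in 𝓝[>] (0:ℝ),
        ∃ G : Site 2 × Site 2 → ℂ, (∀ c, ‖G c‖ ≤ δ⁻¹) ∧
          ∀ S : Finset (Site 2 × Fin 2), (∀ p ∈ S, medialPoint δ (medialVertexOf p) ∈ K) →
            ∑ p ∈ S, (‖halfCRForm Complex.I p G‖ / δ +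
              ‖(bondDartObservable (Λ δ) δ (1 / 3) (medialCornersAt p.1 p.2 1) - G (medialCornersAt p.1 p.2 1)) +
                (bondDartObservable (Λ δ) δ (1 / 3) (medialCornersAt p.1 p.2 3) - G (medialCornersAt p.1 p.2 3)) -
                (bondDartObservable (Λ δ) δ (1 / 3) (medialCornersAt p.1 p.2 0) - G (medialCornersAt p.1 p.2 0)) -
                (bondDartObservable (Λ δ) δ (1 / 3) (medialCornersAt p.1 p.2 2) - G (medialCornersAt p.1 p.2 2))‖ +
              ‖∑ k : Fin 4, G (medialCornersAt p.1 p.2 k)‖) ≤ ε * δ ^ (-(5:ℝ) / 3))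
    (D : DobrushinDomain) (Λ : ℝ → DiscreteDobrushin) (hΛ : IsFamily D Λ) (φ : ℂ → ℂ)
    (hφ : ContDiff ℝ (⊤ : ℕ∞) φ) (hc : HasCompactSupport φ) (hs : tsupport φ ⊆ D.carrier) :
    Tendsto (fun δ : ℝ => ((δ ^ ((5:ℝ) / 3) : ℝ) : ℂ) * ∑ᶠ z : MedialVertex,
      F Λ δ z * ((fderiv ℝ φ (medialPoint δ z) 1 + Complex.I * fderiv ℝ φ (medialPoint δ z) Complex.I) / 2))
      (𝓝[>] 0) (𝓝 0) := by
  classical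
  set K := tsupport φ with hKdef
  have hK : IsCompact K := hc.isCompact
  -- constants
  have hKφ : ∀ z ∉ K, φ z = 0 := fun z hz => image_eq_zero_of_notMem_tsupport hz
  have hKd : ∀ z ∉ K, fderiv ℝ φ z = 0 := fun z hz => fderiv_of_notMem_tsupport ℝ hz
  obtain ⟨Bφ, hBφ⟩ := hφ.continuous.bounded_above_of_compact_support hc
  obtain ⟨B1, hB1⟩ := (hφ.continuous_fderiv (by simp)).bounded_above_of_compact_support (hc.fderiv (𝕜 := ℝ))
  set Bd := B1 with hBd
  have hBd1 : ∀ z, ‖(fderiv ℝ φ z 1 + Complex.I * fderiv ℝ φ z Complex.I) / 2‖ ≤ Bd := by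
    intro z
    have h1 : ‖fderiv ℝ φ z 1‖ ≤ B1 := by
      simpa using (fderiv ℝ φ z).le_of_opNorm_le (hB1 z) 1
    have h2 : ‖fderiv ℝ φ z Complex.I‖ ≤ B1 := by
      simpa using (fderiv ℝ φ z).le_of_opNorm_le (hB1 z) Complex.I
    rw [norm_div]
    have : ‖fderiv ℝ φ z 1 + Complex.I * fderiv ℝ φ z Complex.I‖ ≤ B1 + B1 :=
      (norm_add_le _ _).trans (add_le_add h1 (by rw [norm_mul, Complex.norm_I, one_mul]; exact h2))
    have h2' : ‖(2:ℂ)‖ = 2 := by simp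
    rw [h2']; linarith
  have hBd2 : ∀ z, ‖(fderiv ℝ φ z 1 - Complex.I * fderiv ℝ φ z Complex.I) / 2‖ ≤ Bd := by
    intro z
    have h1 : ‖fderiv ℝ φ z 1‖ ≤ B1 := by
      simpa using (fderiv ℝ φ z).le_of_opNorm_le (hB1 z) 1
    have h2 : ‖fderiv ℝ φ z Complex.I‖ ≤ B1 := by
      simpa using (fderiv ℝ φ z).le_of_opNorm_le (hB1 z) Complex.I
    rw [norm_div]
    have : ‖fderiv ℝ φ z 1 - Complex.I * fderiv ℝ φ z Complex.I‖ ≤ B1 + B1 :=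
      (norm_sub_le _ _).trans (add_le_add h1 (by rw [norm_mul, Complex.norm_I, one_mul]; exact h2))
    have h2' : ‖(2:ℂ)‖ = 2 := by simp
    rw [h2']; linarith
  have hBφ0 : 0 ≤ Bφ := (norm_nonneg _).trans (hBφ 0)
  have hBd0 : 0 ≤ Bd := (norm_nonneg _).trans (hBd1 0)
  obtain ⟨Cφ, hCφ⟩ := hC φ hφ hc
  obtain ⟨C', hC'⟩ := hT
  obtain ⟨CN, hCN⟩ := hN K hK
  -- ε / δ management
  rw [Metric.tendsto_nhds]
  intro ε₀ hε₀
  set L := 2 * Bd + 8 * Bφ with hL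
  have hL0 : 0 ≤ L := by positivity
  have hL1 : 0 < L + 1 := by positivity
  set ε := ε₀ / (2 * (L + 1)) with hεdef
  have hε : 0 < ε := by positivity
  have hεL : L * ε ≤ ε₀ / 2 := by
    have h1 : L * ε ≤ (L + 1) * ε := mul_le_mul_of_nonneg_right (by linarith) hε.le
    have h2 : (L + 1) * ε = ε₀ / 2 := by
      rw [hεdef]; field_simp
    linarith
  -- δ^{2/3} → 0
  have ht0 : Tendsto (fun δ : ℝ => δ ^ ((2:ℝ) / 3)) (𝓝[>] (0:ℝ)) (𝓝 0) := by
    have hc' : Tendsto (fun δ : ℝ => δ ^ ((2:ℝ) / 3)) (𝓝 (0:ℝ)) (𝓝 ((0:ℝ) ^ ((2:ℝ) / 3))) :=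
      (Real.continuousAt_rpow_const 0 ((2:ℝ) / 3) (Or.inr (by norm_num))).tendsto
    rw [Real.zero_rpow (by norm_num)] at hc'
    exact hc'.mono_left nhdsWithin_le_nhds
  have ht : Tendsto (fun δ : ℝ => 4 * |C' * Cφ| * |CN| * δ ^ ((2:ℝ) / 3)) (𝓝[>] (0:ℝ)) (𝓝 0) := by
    simpa using ht0.const_mul (4 * |C' * Cφ| * |CN|)
  have E5 : ∀ᶠ δ in 𝓝[>] (0:ℝ), 4 * |C' * Cφ| * |CN| * δ ^ ((2:ℝ) / 3) < ε₀ / 2 :=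
    ht.eventually (gt_mem_nhds (half_pos hε₀))
  have E4 : ∀ᶠ δ in 𝓝[>] (0:ℝ), δ ∈ Set.Ioo (0:ℝ) 1 := Ioo_mem_nhdsGT one_pos
  filter_upwards [finsum_eq_kappa_sum D Λ hΛ φ hc hs, hV D Λ hΛ K hK hs ε hε, hSpl D Λ hΛ K hK hs ε hε,
    E4, E5] with δ h1 h2 h3 hδ h5
  have hδ0 : 0 < δ := hδ.1
  have hδ1 : δ ≤ 1 := hδ.2.le
  obtain ⟨S, hS, hcard⟩ := hCN δ hδ0 hδ1
  have hCN0 : 0 ≤ CN := le_trans (by positivity) hcard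
  obtain ⟨G, hG, hGsum⟩ := h3
  set Fd : Site 2 × Site 2 → ℂ := fun c => bondDartObservable (Λ δ) δ (1 / 3) c with hFd_def
  have hFd : ∀ c, ‖Fd c‖ ≤ 1 := fun c => Parafermion.norm_bondDartObservable_le_one _ _ _ _
  set SKset := S.filter (fun p => medialPoint δ (medialVertexOf p) ∈ K) with hSKset
  have hSK_mem : ∀ p ∈ SKset, medialPoint δ (medialVertexOf p) ∈ K := fun p hp =>
    (Finset.mem_filter.1 hp).2
  have hV' := h2 SKset hSK_mem
  have hSpl' := hGsum SKset hSK_mem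
  have core := stub_coreEstimate hR φ K hKφ hKd hBφ hBd1 hBd2 hδ0 hδ1 (hC' φ Cφ hCφ δ hδ0 hδ1) S hS
    hcard Fd G hFd hG SKset (fun p hp hK => Finset.mem_filter.2 ⟨hp, hK⟩) hV' hSpl'
  rw [h1 S hS, dist_zero_right, norm_mul, norm_mul, Complex.norm_real, Complex.norm_real,
    Real.norm_of_nonneg (Real.rpow_nonneg hδ0.le _),
    Real.norm_of_nonneg
      (Summit.CriticalPhenomena.CardyFormulaZ2.Cruxes.ParafermionPrecompact.KenyonStreamSecondRelation.kappa_pos_le).1.le]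
  have hκ := Summit.CriticalPhenomena.CardyFormulaZ2.Cruxes.ParafermionPrecompact.KenyonStreamSecondRelation.kappa_pos_le
  have hnn : 0 ≤ ‖∑ p ∈ S, (fderiv ℝ φ (medialPoint δ (medialVertexOf p)) 1 +
      Complex.I * fderiv ℝ φ (medialPoint δ (medialVertexOf p)) Complex.I) / 2 *
      ∑ k : Fin 4, bondDartObservable (Λ δ) δ (1 / 3) (medialCornersAt p.1 p.2 k)‖ := norm_nonneg _
  have habs : |C' * Cφ| * CN ≤ |C' * Cφ| * |CN| :=
    mul_le_mul_of_nonneg_left (le_abs_self _) (abs_nonneg _)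
  calc δ ^ ((5:ℝ) / 3) * (kappa * ‖∑ p ∈ S, (fderiv ℝ φ (medialPoint δ (medialVertexOf p)) 1 +
          Complex.I * fderiv ℝ φ (medialPoint δ (medialVertexOf p)) Complex.I) / 2 *
          ∑ k : Fin 4, bondDartObservable (Λ δ) δ (1 / 3) (medialCornersAt p.1 p.2 k)‖)
      ≤ δ ^ ((5:ℝ) / 3) * (1 * (2 * |C' * Cφ| * (1 + δ⁻¹) * CN + (2 * Bd + 8 * Bφ) * ε * δ ^ (-(5:ℝ) / 3))) := by
        refine mul_le_mul_of_nonneg_left ?_ (Real.rpow_nonneg hδ0.le _)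
        exact mul_le_mul hκ.2 core hnn zero_le_one
    _ = 2 * |C' * Cφ| * CN * (δ ^ ((5:ℝ) / 3) * (1 + δ⁻¹)) +
          L * ε * (δ ^ ((5:ℝ) / 3) * δ ^ (-(5:ℝ) / 3)) := by rw [hL]; ring
    _ ≤ 2 * |C' * Cφ| * CN * (2 * δ ^ ((2:ℝ) / 3)) + L * ε * 1 := by
        rw [rpow_aux3 hδ0]
        refine add_le_add (mul_le_mul_of_nonneg_left (rpow_aux4 hδ0 hδ1) (by positivity)) le_rfl
    _ = 4 * (|C' * Cφ| * CN) * δ ^ ((2:ℝ) / 3) + L * ε := by ring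
    _ ≤ 4 * (|C' * Cφ| * |CN|) * δ ^ ((2:ℝ) / 3) + L * ε := by
        refine add_le_add (mul_le_mul_of_nonneg_right (mul_le_mul_of_nonneg_left habs (by norm_num))
          (Real.rpow_nonneg hδ0.le _)) le_rfl
    _ < ε₀ / 2 + ε₀ / 2 := by
        refine add_lt_add_of_lt_of_le ?_ hεL
        simpa [mul_assoc] using h5
    _ = ε₀ := by ring


/-- **Registered stub `stub_composition` (the bypass), proved.** [folklore] -/
theorem stub_composition :
    (∀ (S : Finset (Site 2 × Fin 2)) (w : Site 2 × Fin 2 → Fin 4 → ℂ) (Φ : Site 2 × Site 2 → ℂ),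
      (∀ (p : Site 2 × Fin 2) (k : Fin 4), w p k ≠ 0 → p ∈ S ∧ twin p.1 p.2 k ∈ S) →
      ∑ p ∈ S, ∑ k : Fin 4, w p k * Φ (medialCornersAt p.1 p.2 k) =
        (1 / 2 : ℂ) * ∑ p ∈ S, ∑ k : Fin 4,
          (w p k + w (twin p.1 p.2 k) (k + 2)) * Φ (medialCornersAt p.1 p.2 k)) →
    (∀ (φ : ℂ → ℂ), ContDiff ℝ (⊤ : ℕ∞) φ → HasCompactSupport φ →
      ∃ C : ℝ, ∀ (m v : ℂ), ‖v‖ ≤ 1 →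
        ‖φ (m + v) - φ (m - v) - 2 * fderiv ℝ φ m v‖ ≤ C * ‖v‖ ^ 3 ∧
        ‖fderiv ℝ φ (m + v) 1 + fderiv ℝ φ (m - v) 1 - 2 * fderiv ℝ φ m 1‖ ≤ C * ‖v‖ ^ 2 ∧
        ‖fderiv ℝ φ (m + v) Complex.I + fderiv ℝ φ (m - v) Complex.I - 2 * fderiv ℝ φ m Complex.I‖
          ≤ C * ‖v‖ ^ 2) →
    (∃ C' : ℝ, ∀ (φ : ℂ → ℂ) (C : ℝ),
      (∀ (m v : ℂ), ‖v‖ ≤ 1 →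
        ‖φ (m + v) - φ (m - v) - 2 * fderiv ℝ φ m v‖ ≤ C * ‖v‖ ^ 3 ∧
        ‖fderiv ℝ φ (m + v) 1 + fderiv ℝ φ (m - v) 1 - 2 * fderiv ℝ φ m 1‖ ≤ C * ‖v‖ ^ 2 ∧
        ‖fderiv ℝ φ (m + v) Complex.I + fderiv ℝ φ (m - v) Complex.I - 2 * fderiv ℝ φ m Complex.I‖
          ≤ C * ‖v‖ ^ 2) →
      ∀ (δ : ℝ), 0 < δ → δ ≤ 1 → ∀ (p : Site 2 × Fin 2) (k : Fin 4),
        dist (medialPoint δ (medialVertexOf p)) (medialPoint δ (medialVertexOf (twin p.1 p.2 k))) ≤ δ ∧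
        ‖((fderiv ℝ φ (medialPoint δ (medialVertexOf p)) 1 +
              Complex.I * fderiv ℝ φ (medialPoint δ (medialVertexOf p)) Complex.I) / 2 +
            Complex.I * (-1) ^ (k.val + 1) *
              ((fderiv ℝ φ (medialPoint δ (medialVertexOf p)) 1 -
                Complex.I * fderiv ℝ φ (medialPoint δ (medialVertexOf p)) Complex.I) / 2) -
            2 * (1 - Complex.I) / δ * coeff Complex.I k * φ (medialPoint δ (medialVertexOf p))) +
          ((fderiv ℝ φ (medialPoint δ (medialVertexOf (twin p.1 p.2 k))) 1 +
              Complex.I * fderiv ℝ φ (medialPoint δ (medialVertexOf (twin p.1 p.2 k))) Complex.I) / 2 +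
            Complex.I * (-1) ^ ((k + 2 : Fin 4).val + 1) *
              ((fderiv ℝ φ (medialPoint δ (medialVertexOf (twin p.1 p.2 k))) 1 -
                Complex.I * fderiv ℝ φ (medialPoint δ (medialVertexOf (twin p.1 p.2 k))) Complex.I) / 2) -
            2 * (1 - Complex.I) / δ * coeff Complex.I (k + 2) *
              φ (medialPoint δ (medialVertexOf (twin p.1 p.2 k))))‖ ≤ C' * C * δ ^ 2) →
    (∀ (K : Set ℂ), IsCompact K → ∃ C : ℝ, ∀ (δ : ℝ), 0 < δ → δ ≤ 1 →
      ∃ S : Finset (Site 2 × Fin 2),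
        (∀ p : Site 2 × Fin 2, medialPoint δ (medialVertexOf p) ∈ Metric.cthickening 1 K → p ∈ S) ∧
        δ ^ 2 * (S.card : ℝ) ≤ C) →
    (∀ (D : DobrushinDomain) (Λ : ℝ → DiscreteDobrushin), IsFamily D Λ →
      ∀ (K : Set ℂ), IsCompact K → K ⊆ D.carrier → ∀ ε > (0:ℝ), ∀ᶠ δ in 𝓝[>] (0:ℝ),
        ∀ S : Finset (Site 2 × Fin 2), (∀ p ∈ S, medialPoint δ (medialVertexOf p) ∈ K) →
          ∑ p ∈ S, ‖halfCRForm Complex.I p (fun c => bondDartObservable (Λ δ) δ (1 / 3) c)‖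
            ≤ ε * δ ^ (-(2:ℝ) / 3)) →
    (∀ (D : DobrushinDomain) (Λ : ℝ → DiscreteDobrushin), IsFamily D Λ →
      ∀ (K : Set ℂ), IsCompact K → K ⊆ D.carrier → ∀ ε > (0:ℝ), ∀ᶠ δ in 𝓝[>] (0:ℝ),
        ∃ G : Site 2 × Site 2 → ℂ, (∀ c, ‖G c‖ ≤ δ⁻¹) ∧
          ∀ S : Finset (Site 2 × Fin 2), (∀ p ∈ S, medialPoint δ (medialVertexOf p) ∈ K) →
            ∑ p ∈ S, (‖halfCRForm Complex.I p G‖ / δ +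
              ‖(bondDartObservable (Λ δ) δ (1 / 3) (medialCornersAt p.1 p.2 1) - G (medialCornersAt p.1 p.2 1)) +
                (bondDartObservable (Λ δ) δ (1 / 3) (medialCornersAt p.1 p.2 3) - G (medialCornersAt p.1 p.2 3)) -
                (bondDartObservable (Λ δ) δ (1 / 3) (medialCornersAt p.1 p.2 0) - G (medialCornersAt p.1 p.2 0)) -
                (bondDartObservable (Λ δ) δ (1 / 3) (medialCornersAt p.1 p.2 2) - G (medialCornersAt p.1 p.2 2))‖ +
              ‖∑ k : Fin 4, G (medialCornersAt p.1 p.2 k)‖) ≤ ε * δ ^ (-(5:ℝ) / 3)) →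
    ∀ (D : DobrushinDomain) (Λ : ℝ → DiscreteDobrushin), IsFamily D Λ → ∀ (φ : ℂ → ℂ),
      ContDiff ℝ (⊤ : ℕ∞) φ → HasCompactSupport φ → tsupport φ ⊆ D.carrier →
        Tendsto (fun δ : ℝ => ((δ ^ ((5:ℝ) / 3) : ℝ) : ℂ) * ∑ᶠ z : MedialVertex,
          F Λ δ z * ((fderiv ℝ φ (medialPoint δ z) 1 + Complex.I * fderiv ℝ φ (medialPoint δ z) Complex.I) / 2))
          (𝓝[>] 0) (𝓝 0) :=
  fun hR hC hT hN hV hSpl => composition_holds hR hC hT hN hV hSpl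

end Summit.CriticalPhenomena.CardyFormulaZ2.Theorems.WeakHolomorphy.SplitBypass

end
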